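import Mathlib
import Summits.Ventures.PercRepro.TriangleCapHangEdge

/-!
# PercRepro — THE ONE-TRIANGLE FAMILY OF THE ROW `a = 3`: `K_{3,k−4}` minus an `(r − 1)`-star with a vertex
hung on an edge is a `K₄⁻`-free graph on the cell `(k, 3, r)` exactly `2 (k − 7)` below the closed form, and it
is a spanning subgraph of no `K(A, Aᶜ)` (p3, gen 43; part 189)

`tFamily n r` on `Fin (n + 1)` (`k = n + 1`) is `hangEdge (bipMinusStar n 3 (r − 1)) 1 (n − 1)`: the complete
bipartite graph `K_{3,n−3}` with parts `{0, 1, 2}` and `{3, …, n − 1}`, minus the star of `r − 1` pairs at the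
small-side vertex `0`, plus the vertex `n` hung on the edge `{1, n − 1}` (`1` is not the star centre, `n − 1` is
off the star since `n ≥ r + 3`). `tFamily_value (1 ≤ r) (r + 6 ≤ n)`: `K₄⁻`-free, `3 (k − 3) − r` edges,
`Σ_v d(v)² + r (k − 1 − r) + 2 (k − 7) = m k` (degrees `n − 3 − (r − 1)`, `n − 2`, `n − 3`; `2` on the `r − 1`
star leaves, `3` on the other large-side vertices but `4` at `n − 1`; `2` at the hung vertex), and not
`BipSub` for any `A`. This is the witness of §10bu(c): the second-best value of the row `a = 3` at `r = 1`, and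
the family `T` of the stability table §10bt(e) at `a = 3`. Axioms: standard.
-/

namespace PercRepro

namespace TriangleCap

namespace C047

open Finset

/-- The one-triangle family on the cell `(n + 1, 3, r)`: `K_{3,n−3}` minus an `(r − 1)`-star at `0`, with the
vertex `n` hung on the edge `{1, n − 1}`. -/
abbrev tFamily (n r : ℕ) (hn : 2 ≤ n) : SimpleGraph (Fin (n + 1)) :=
  hangEdge (bipMinusStar n 3 (r - 1)) ⟨1, by omega⟩ ⟨n - 1, by omega⟩

/-- The edge `{1, n − 1}` of `bipMinusStar n 3 (r − 1)` (for `4 ≤ n`). -/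
theorem bipMinusStar_adj_one_last (n r : ℕ) (hn : 4 ≤ n) :
    (bipMinusStar n 3 (r - 1)).Adj ⟨1, by omega⟩ ⟨n - 1, by omega⟩ := by
  rw [bipMinusStar_adj]
  simp only
  refine ⟨?_, ?_⟩
  · exact Or.inl ⟨by omega, by omega⟩
  · omega

/-- `1` and `n − 1` have no common neighbour in `bipMinusStar n 3 (r − 1)` (it is bipartite). -/
theorem bipMinusStar_no_common (n r : ℕ) (hn : 4 ≤ n) (w : Fin n) :
    ¬ ((bipMinusStar n 3 (r - 1)).Adj ⟨1, by omega⟩ w ∧ (bipMinusStar n 3 (r - 1)).Adj ⟨n - 1, by omega⟩ w) := by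
  rintro ⟨h1, h2⟩
  have e1 := bipMinusStar_bipartite n 3 (r - 1) _ _ h1
  have e2 := bipMinusStar_bipartite n 3 (r - 1) _ _ h2
  simp only [mem_filter, mem_univ, true_and] at e1 e2
  omega

/-- The degree of `1` in `bipMinusStar n 3 (r − 1)` is `n − 3`. -/
theorem deg_bipMinusStar_one (n r : ℕ) (hr : 1 ≤ r) (hn : r + 3 ≤ n) :
    deg (bipMinusStar n 3 (r - 1)) ⟨1, by omega⟩ = n - 3 := by
  rw [deg_bipMinusStar n 3 (r - 1) (by norm_num) (by omega)]
  simp only [rightStar, mem_filter, mem_univ, true_and]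
  rw [if_neg (by omega), if_neg (by omega)]
  exact deg_bip_of_lt n 3 (by omega) _ (by simp)

/-- The degree of `n − 1` in `bipMinusStar n 3 (r − 1)` is `3`. -/
theorem deg_bipMinusStar_last (n r : ℕ) (hr : 1 ≤ r) (hn : r + 3 ≤ n) :
    deg (bipMinusStar n 3 (r - 1)) ⟨n - 1, by omega⟩ = 3 := by
  rw [deg_bipMinusStar n 3 (r - 1) (by norm_num) (by omega)]
  simp only [rightStar, mem_filter, mem_univ, true_and]
  rw [if_neg (by omega), if_neg (by omega)]
  exact deg_bip_of_not_lt n 3 (by omega) _ (by simp; omega)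

/-- **THE ONE-TRIANGLE FAMILY ON THE CELL `(n + 1, 3, r)`:** `K₄⁻`-free, `3 (n − 2) − r` edges (the cell
`m + 9 + r = 3 k`, `k = n + 1`), `Σ_v d(v)² + r (k − 1 − r) + 2 (k − 7) = m k`, and a spanning subgraph of no
`K(A, Aᶜ)`. -/
theorem tFamily_value (n r : ℕ) (hr : 1 ≤ r) (hn : r + 6 ≤ n) :
    K4mFree (tFamily n r (by omega)) ∧
      (tFamily n r (by omega)).edgeFinset.card + 9 + r = 3 * Fintype.card (Fin (n + 1)) ∧
      ∑ v, deg (tFamily n r (by omega)) v * deg (tFamily n r (by omega)) v +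
          r * (Fintype.card (Fin (n + 1)) - 1 - r) + 2 * (Fintype.card (Fin (n + 1)) - 7) =
        (tFamily n r (by omega)).edgeFinset.card * Fintype.card (Fin (n + 1)) ∧
      ∀ A : Finset (Fin (n + 1)), ¬ BipSub (tFamily n r (by omega)) A := by
  have hadj := bipMinusStar_adj_one_last n r (by omega)
  have hne : (⟨1, by omega⟩ : Fin n) ≠ ⟨n - 1, by omega⟩ := by
    intro h
    rw [Fin.ext_iff] at h
    simp only at h
    omega
  have hE := card_edges_bipMinusStar n 3 (r - 1) (by norm_num) (by omega)
  have hS := (sums_bipMinusStar n 3 (r - 1) (by norm_num) (by omega)).2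
  have hd1 := deg_bipMinusStar_one n r hr (by omega)
  have hd2 := deg_bipMinusStar_last n r hr (by omega)
  have hcard : Fintype.card (Fin (n + 1)) = n + 1 := Fintype.card_fin _
  have hE' : (tFamily n r (by omega)).edgeFinset.card = (bipMinusStar n 3 (r - 1)).edgeFinset.card + 2 :=
    card_edges_hangEdge (bipMinusStar n 3 (r - 1)) hne
  have hS' : ∑ v, deg (tFamily n r (by omega)) v * deg (tFamily n r (by omega)) v =
      ∑ v, deg (bipMinusStar n 3 (r - 1)) v * deg (bipMinusStar n 3 (r - 1)) v +
        2 * (deg (bipMinusStar n 3 (r - 1)) ⟨1, by omega⟩ + deg (bipMinusStar n 3 (r - 1)) ⟨n - 1, by omega⟩) + 6 :=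
    sum_deg_sq_hangEdge (bipMinusStar n 3 (r - 1)) hne
  rw [hd1, hd2] at hS'
  refine ⟨?_, ?_, ?_, ?_⟩
  · exact k4mFree_hangEdge _ (k4mFree_bipMinusStar n 3 (r - 1)) hadj (bipMinusStar_no_common n r (by omega))
  · rw [hE', hcard]
    omega
  · rw [hS', hE', hcard]
    -- `S + (r − 1)(2n − (r − 1) − 1) = 3 (n − 3) n`, `E + (r − 1) = 3 (n − 3)`
    obtain ⟨S, hSdef⟩ : ∃ S, ∑ v, deg (bipMinusStar n 3 (r - 1)) v * deg (bipMinusStar n 3 (r - 1)) v = S :=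
      ⟨_, rfl⟩
    obtain ⟨E, hEdef⟩ : ∃ E, (bipMinusStar n 3 (r - 1)).edgeFinset.card = E := ⟨_, rfl⟩
    rw [hSdef] at hS ⊢
    rw [hEdef] at hE ⊢
    obtain ⟨t, rfl⟩ : ∃ t, r = t + 1 := ⟨r - 1, by omega⟩
    obtain ⟨u, rfl⟩ : ∃ u, n = u + t + 7 := ⟨n - t - 7, by omega⟩
    simp only [Nat.add_sub_cancel] at hS hE ⊢
    have e1 : u + t + 7 - 3 = u + t + 4 := by omega
    have e2 : 2 * (u + t + 7) - t - 1 = 2 * u + t + 13 := by omega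
    have e3 : u + t + 7 - (t + 1) = u + 6 := by omega
    have e4 : u + t + 7 + 1 - 7 = u + t + 1 := by omega
    have e5 : u + t + 7 - 3 + 3 = u + t + 7 := by omega
    rw [e1] at hS hE
    rw [e2] at hS
    rw [e3, e4, e5]
    nlinarith [hS, hE]
  · intro A
    exact not_bipSub_hangEdge _ hadj A

end C047

end TriangleCap

end PercRepro
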